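import Literature.Geometry.Manifold.ModelChange
import Literature.Topology.FourManifolds.RegularLevelSplitting
import Mathlib.Geometry.Manifold.Instances.Sphere
import Mathlib.Analysis.InnerProductSpace.Calculus
import Mathlib.Analysis.SpecialFunctions.Trigonometric.Deriv
import HarnessLib

/-!
# The tube of the diagonal in `Sᵏ × Sᵏ` as a compact manifold with boundary

Topic `Literature/Topology/FourManifolds` (fact seat of
`Literature.Topology.FourManifolds.HomotopySphere.exists_intersectionForm_equivalent_e8Form`,
Kosinski's `E₈` plumbing `M(4m)` of eight copies of the tangent disc bundle of `S²ᵐ`,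
*Differential Manifolds* (1993), VI.12). The plumbing pieces are tubes of the diagonal
`Δ ⊂ Sᵏ × Sᵏ`: the normal bundle of the diagonal is the tangent bundle (Milnor–Stasheff,
*Characteristic classes* (1974), Lemma 11.5), and the tube

  `N_c = {(p, q) ∈ Sᵏ × Sᵏ | ⟪p, q⟫ ≥ c}`,  `-1 < c < 1`,

(the pairs at spherical distance `≤ arccos c`) is its closed disc bundle. This file makes `N_c`
available to the tree's manifold-with-boundary machinery: it is the **regular superlevel set**
(`Literature.Topology.FourManifolds.RegularSuperlevel`, `RegularLevelSplitting.lean`; Milnor,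
*Morse theory* (1963), Thm. 3.1: "`Mᵃ = f⁻¹(-∞, a]` is a smooth manifold with boundary") of the
smooth function `f(p, q) = ⟪p, q⟫` on the closed manifold `Sᵏ × Sᵏ`, every `c ∈ (-1, 1)` being a
regular value of `f` (its critical points are the pairs `q = ±p`, where `f = ±1`).

* `SphereProd.PM k n hkn` — `Sᵏ × Sᵏ` re-charted on `ℝⁿ⁺¹` (`k + k = n + 1`), the product atlas
  followed by a linear change of model (`Literature.Geometry.Manifold.Rechart`), a `C^∞` manifold
  for `𝓡 (n + 1)` (`SphereProd.instIsManifoldPM`);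
* `SphereProd.dotFn` — `f(p, q) = ⟪p, q⟫`, smooth (`contMDiff_dotFn`);
* `SphereProd.not_isMCriticalPt_dotFn` — a point with `|f| < 1` is not critical: along the great
  circle through `q` towards `p` the function has derivative `√(1 - f²) ≠ 0`;
* `SphereProd.isRegularLevel_dotFn` — every `c ∈ (-1, 1)` is a regular level;
* `SphereProd.Tube k n hkn hc` — **the tube `N_c = {⟪p, q⟫ ≥ c}`** as a compact `C^∞` manifold
  with boundary `{⟪p, q⟫ = c}` (instances from `RegularSublevel`), with its inclusion into
  `Sᵏ × Sᵏ` and the membership lemmas.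

Everything is proved; no named facts (D-0026).

## References

* A. Kosinski, *Differential Manifolds* (1993), VI.12 (the plumbing `M(4n)`). [Kosinski1993]
* J. Milnor, J. Stasheff, *Characteristic classes* (1974), §11, Lemma 11.5 and Thm. 11.1 (the
  normal bundle of the diagonal is the tangent bundle; tubular neighbourhood of `Δ`).
  [MilnorStasheff1974]
* J. Milnor, *Morse theory* (1963), §3, Thm. 3.1 (regular sublevel sets). [Milnor1963]
-/

open scoped Manifold ContDiff Topology RealInnerProductSpace
open Set Function Module

noncomputable section

namespace Literature.Topology.FourManifolds

open Literature.Geometry.Manifold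

/-- Local notation: `𝔼 n` is the model Euclidean space `EuclideanSpace ℝ (Fin n)`. -/
local notation "𝔼 " n:arg => EuclideanSpace ℝ (Fin n)

/-- Local notation: `𝕊 n` is the unit sphere in `EuclideanSpace ℝ (Fin (n + 1))`. -/
local notation "𝕊 " n:arg => (Metric.sphere (0 : EuclideanSpace ℝ (Fin (n + 1))) 1)

namespace SphereProd

variable (k n : ℕ)

/-! ### `Sᵏ × Sᵏ` re-charted on `ℝⁿ⁺¹`, `k + k = n + 1` -/

/-- The linear change of model `ℝᵏ × ℝᵏ ≃L ℝⁿ⁺¹` (`k + k = n + 1`). [folklore] -/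
def tubeModelLin (hkn : k + k = n + 1) : (𝔼 k × 𝔼 k) ≃L[ℝ] 𝔼 (n + 1) :=
  ContinuousLinearEquiv.ofFinrankEq (by simp [Module.finrank_prod]; omega)

/-- The change of model space `ModelProd ℝᵏ ℝᵏ ≃ₜ ℝⁿ⁺¹` underlying `tubeModelLin`. [folklore] -/
def tubeModelHomeo (hkn : k + k = n + 1) : ModelProd (𝔼 k) (𝔼 k) ≃ₜ 𝔼 (n + 1) :=
  (tubeModelLin k n hkn).toHomeomorph

/-- `tubeModelHomeo = tubeModelLin ∘ I` for the product model with corners `I` (the identity of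
the product vector space). [folklore] -/
theorem tubeModelHomeo_apply (hkn : k + k = n + 1) (x : ModelProd (𝔼 k) (𝔼 k)) :
    tubeModelHomeo k n hkn x = tubeModelLin k n hkn (((𝓡 k).prod (𝓡 k)) x) :=
  rfl

/-- **`Sᵏ × Sᵏ` re-charted on `ℝⁿ⁺¹`** (`k + k = n + 1`): the type synonym
`Rechart (tubeModelHomeo …) (Sᵏ × Sᵏ)` carrying the product atlas followed by the linear change of
model (Lee 2013, Example 1.34 with Prop. 1.17). [folklore] -/
abbrev PM (hkn : k + k = n + 1) : Type :=
  Rechart (tubeModelHomeo k n hkn) ((𝕊 k) × (𝕊 k))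

/-- `Sᵏ × Sᵏ` re-charted on `ℝⁿ⁺¹` is a `C^∞` manifold for `𝓡 (n + 1)` (`Rechart.isManifold`; the
change of model is linear). [folklore] -/
instance instIsManifoldPM (hkn : k + k = n + 1) : IsManifold (𝓡 (n + 1)) ∞ (PM k n hkn) :=
  Rechart.isManifold (n := ∞) _ _
    (Rechart.contMDiff_of_apply_eq_linear _ (tubeModelLin k n hkn) (tubeModelHomeo_apply k n hkn))
    (Rechart.contMDiff_symm_of_apply_eq_linear _ (tubeModelLin k n hkn)
      (tubeModelHomeo_apply k n hkn))

variable {k n} {hkn : k + k = n + 1}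

/-- The identity `PM → Sᵏ × Sᵏ` is smooth. [folklore] -/
theorem contMDiff_out :
    ContMDiff (𝓡 (n + 1)) ((𝓡 k).prod (𝓡 k)) ∞ (Rechart.out (tubeModelHomeo k n hkn) ((𝕊 k) × (𝕊 k))) :=
  Rechart.contMDiff_out (n := ∞) _ _
    (Rechart.contMDiff_of_apply_eq_linear _ (tubeModelLin k n hkn) (tubeModelHomeo_apply k n hkn))
    (Rechart.contMDiff_symm_of_apply_eq_linear _ (tubeModelLin k n hkn)
      (tubeModelHomeo_apply k n hkn))

/-- The identity `Sᵏ × Sᵏ → PM` is smooth. [folklore] -/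
theorem contMDiff_into :
    ContMDiff ((𝓡 k).prod (𝓡 k)) (𝓡 (n + 1)) ∞ (Rechart.into (tubeModelHomeo k n hkn) ((𝕊 k) × (𝕊 k))) :=
  Rechart.contMDiff_into (n := ∞) _ _
    (Rechart.contMDiff_of_apply_eq_linear _ (tubeModelLin k n hkn) (tubeModelHomeo_apply k n hkn))
    (Rechart.contMDiff_symm_of_apply_eq_linear _ (tubeModelLin k n hkn)
      (tubeModelHomeo_apply k n hkn))

/-! ### The function `f(p, q) = ⟪p, q⟫` -/

/-- The two points of `Sᵏ` underlying a point of `PM`. [folklore] -/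
abbrev pt (x : PM k n hkn) : (𝕊 k) × (𝕊 k) := Rechart.out (tubeModelHomeo k n hkn) _ x

/-- **`f(p, q) = ⟪p, q⟫`**, the cosine of the spherical distance, on `Sᵏ × Sᵏ` (re-charted).
[cite: MilnorStasheff1974, §11 Lemma 11.5] -/
def dotFn (x : PM k n hkn) : ℝ := ⟪((pt x).1 : 𝔼 (k + 1)), ((pt x).2 : 𝔼 (k + 1))⟫

/-- `(p, q) ↦ ⟪p, q⟫` is smooth on `Sᵏ × Sᵏ` (product charts). [folklore] -/
theorem contMDiff_inner_sphereProd :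
    ContMDiff ((𝓡 k).prod (𝓡 k)) 𝓘(ℝ, ℝ) ∞
      (fun pq : (𝕊 k) × (𝕊 k) => ⟪(pq.1 : 𝔼 (k + 1)), (pq.2 : 𝔼 (k + 1))⟫) := by
  haveI : Fact (finrank ℝ (𝔼 (k + 1)) = k + 1) := ⟨finrank_euclideanSpace_fin⟩
  have h1 : ContMDiff ((𝓡 k).prod (𝓡 k)) 𝓘(ℝ, 𝔼 (k + 1)) ∞ fun pq : (𝕊 k) × (𝕊 k) => (pq.1 : 𝔼 (k + 1)) :=
    contMDiff_coe_sphere.comp contMDiff_fst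
  have h2 : ContMDiff ((𝓡 k).prod (𝓡 k)) 𝓘(ℝ, 𝔼 (k + 1)) ∞ fun pq : (𝕊 k) × (𝕊 k) => (pq.2 : 𝔼 (k + 1)) :=
    contMDiff_coe_sphere.comp contMDiff_snd
  have h12 : ContMDiff ((𝓡 k).prod (𝓡 k)) 𝓘(ℝ, 𝔼 (k + 1) × 𝔼 (k + 1)) ∞
      fun pq : (𝕊 k) × (𝕊 k) => ((pq.1 : 𝔼 (k + 1)), (pq.2 : 𝔼 (k + 1))) :=
    h1.prodMk_space h2
  exact (contDiff_inner (E := 𝔼 (k + 1))).comp_contMDiff h12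

/-- **`f = ⟪p, q⟫` is smooth on `PM`.** [folklore] -/
theorem contMDiff_dotFn : ContMDiff (𝓡 (n + 1)) 𝓘(ℝ, ℝ) ∞ (dotFn (hkn := hkn)) :=
  contMDiff_inner_sphereProd.comp contMDiff_out

/-- `|f| ≤ 1` (Cauchy–Schwarz for unit vectors). [folklore] -/
theorem abs_dotFn_le_one (x : PM k n hkn) : |dotFn x| ≤ 1 := by
  have h := abs_real_inner_le_norm ((pt x).1 : 𝔼 (k + 1)) ((pt x).2 : 𝔼 (k + 1))
  simpa [dotFn] using h

/-! ### No critical points off `q = ±p` -/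

section Critical

variable (x : PM k n hkn)

/-- The first point `p`. [folklore] -/
abbrev pP : 𝔼 (k + 1) := ((pt x).1 : 𝔼 (k + 1))
/-- The second point `q`. [folklore] -/
abbrev pQ : 𝔼 (k + 1) := ((pt x).2 : 𝔼 (k + 1))

/-- `‖p‖ = 1`. [folklore] -/
theorem norm_pP : ‖pP x‖ = 1 := norm_eq_of_mem_sphere (pt x).1
/-- `‖q‖ = 1`. [folklore] -/
theorem norm_pQ : ‖pQ x‖ = 1 := norm_eq_of_mem_sphere (pt x).2

/-- The tangent direction `w = p - ⟪p, q⟫ q` at `q` pointing towards `p`. [folklore] -/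
def wVec : 𝔼 (k + 1) := pP x - (dotFn x) • pQ x

/-- `⟪q, w⟫ = 0`. [folklore] -/
theorem inner_pQ_wVec : ⟪pQ x, wVec x⟫ = 0 := by
  simp only [wVec, inner_sub_right, inner_smul_right, dotFn, real_inner_self_eq_norm_sq, norm_pQ,
    one_pow, mul_one, real_inner_comm]
  ring

/-- `⟪p, w⟫ = 1 - f²`. [folklore] -/
theorem inner_pP_wVec : ⟪pP x, wVec x⟫ = 1 - dotFn x ^ 2 := by
  simp only [wVec, inner_sub_right, inner_smul_right, dotFn, real_inner_self_eq_norm_sq, norm_pP,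
    one_pow]
  ring

/-- `‖w‖² = 1 - f²`. [folklore] -/
theorem norm_wVec_sq : ‖wVec x‖ ^ 2 = 1 - dotFn x ^ 2 := by
  rw [← real_inner_self_eq_norm_sq, wVec]
  simp only [inner_sub_left, inner_sub_right, inner_smul_left, inner_smul_right,
    real_inner_self_eq_norm_sq, norm_pP, norm_pQ, RCLike.conj_to_real, real_inner_comm (pP x) (pQ x)]
  simp only [dotFn]
  ring

/-- `w ≠ 0` when `|f| < 1`. [folklore] -/
theorem norm_wVec_pos (hx : |dotFn x| < 1) : 0 < ‖wVec x‖ := by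
  have h1 : dotFn x ^ 2 < 1 := by
    have := abs_lt.1 hx
    nlinarith [sq_abs (dotFn x)]
  have h2 : 0 < ‖wVec x‖ ^ 2 := by rw [norm_wVec_sq]; linarith
  exact lt_of_le_of_ne (norm_nonneg _) fun h => by rw [← h] at h2; simp at h2

/-- The unit vector `u = w / ‖w‖`. [folklore] -/
def uVec : 𝔼 (k + 1) := (‖wVec x‖)⁻¹ • wVec x

/-- The great circle `q_t = cos t • q + sin t • u` through `q` (at `t = 0`) towards `p`, as a curve
in `ℝᵏ⁺¹`. [folklore] -/
def circleVec (t : ℝ) : 𝔼 (k + 1) := Real.cos t • pQ x + Real.sin t • uVec x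

/-- The great circle stays on the unit sphere (`q ⊥ u`, `‖u‖ = 1`). [folklore] -/
theorem norm_circleVec (hx : |dotFn x| < 1) (t : ℝ) : ‖circleVec x t‖ = 1 := by
  have hu : ‖uVec x‖ = 1 := by
    rw [uVec, norm_smul, norm_inv, norm_norm, inv_mul_cancel₀ (norm_wVec_pos x hx).ne']
  have hqu : ⟪pQ x, uVec x⟫ = 0 := by
    rw [uVec, inner_smul_right, inner_pQ_wVec, mul_zero]
  have hqu' : ⟪uVec x, pQ x⟫ = 0 := by rw [real_inner_comm]; exact hqu
  have h : ‖circleVec x t‖ ^ 2 = 1 := by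
    rw [← real_inner_self_eq_norm_sq, circleVec]
    simp only [inner_add_left, inner_add_right, inner_smul_left, inner_smul_right,
      real_inner_self_eq_norm_sq, norm_pQ, hu, hqu, hqu', RCLike.conj_to_real]
    nlinarith [Real.cos_sq_add_sin_sq t]
  exact (pow_eq_one_iff_of_nonneg (norm_nonneg _) two_ne_zero).1 h

/-- `⟪p, q_t⟫ = f cos t + ‖w‖ sin t`. [folklore] -/
theorem inner_pP_circleVec (hx : |dotFn x| < 1) (t : ℝ) :
    ⟪pP x, circleVec x t⟫ = dotFn x * Real.cos t + ‖wVec x‖ * Real.sin t := by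
  have hpu : ⟪pP x, uVec x⟫ = ‖wVec x‖ := by
    rw [uVec, inner_smul_right, inner_pP_wVec, ← norm_wVec_sq, sq, ← mul_assoc,
      inv_mul_cancel₀ (norm_wVec_pos x hx).ne', one_mul]
  rw [circleVec, inner_add_right, inner_smul_right, inner_smul_right, hpu]
  simp only [dotFn]
  ring

/-- The great circle as a curve in `Sᵏ × Sᵏ` (first point fixed). [folklore] -/
def circleProd (hx : |dotFn x| < 1) (t : ℝ) : (𝕊 k) × (𝕊 k) :=
  ((pt x).1, ⟨circleVec x t, by simp [norm_circleVec x hx t]⟩)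

/-- The great circle is smooth into `Sᵏ × Sᵏ`. [folklore] -/
theorem contMDiff_circleProd (hx : |dotFn x| < 1) :
    ContMDiff 𝓘(ℝ, ℝ) ((𝓡 k).prod (𝓡 k)) ∞ (circleProd x hx) := by
  haveI : Fact (finrank ℝ (𝔼 (k + 1)) = k + 1) := ⟨finrank_euclideanSpace_fin⟩
  refine contMDiff_const.prodMk ?_
  have hc : ContMDiff 𝓘(ℝ, ℝ) 𝓘(ℝ, 𝔼 (k + 1)) ∞ (circleVec x) := by
    apply ContDiff.contMDiff
    unfold circleVec
    exact (Real.contDiff_cos.smul contDiff_const).add (Real.contDiff_sin.smul contDiff_const)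
  exact hc.codRestrict_sphere _

/-- The great circle as a curve in `PM`. [folklore] -/
def circlePM (hx : |dotFn x| < 1) (t : ℝ) : PM k n hkn :=
  Rechart.into (tubeModelHomeo k n hkn) _ (circleProd x hx t)

/-- The great circle is smooth into `PM`. [folklore] -/
theorem contMDiff_circlePM (hx : |dotFn x| < 1) :
    ContMDiff 𝓘(ℝ, ℝ) (𝓡 (n + 1)) ∞ (circlePM x hx) :=
  contMDiff_into.comp (contMDiff_circleProd x hx)

/-- At `t = 0` the great circle is at `x`. [folklore] -/
theorem circlePM_zero (hx : |dotFn x| < 1) : circlePM x hx 0 = x := by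
  change Rechart.into _ _ (circleProd x hx 0) = Rechart.into _ _ (Rechart.out _ _ x)
  congr 1
  refine Prod.ext rfl (Subtype.ext ?_)
  simp [circleProd, circleVec]

/-- Along the great circle, `f = f(x) cos t + ‖w‖ sin t`. [folklore] -/
theorem dotFn_circlePM (hx : |dotFn x| < 1) (t : ℝ) :
    dotFn (circlePM x hx t) = dotFn x * Real.cos t + ‖wVec x‖ * Real.sin t := by
  rw [← inner_pP_circleVec x hx t]
  rfl

/-- **A point with `|⟪p, q⟫| < 1` is not a critical point of `f`**: `f` has derivative
`‖w‖ = √(1 - f²) ≠ 0` along the great circle through `q` towards `p`, while at a critical point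
every curve derivative of `f` vanishes (chain rule). [cite: MilnorStasheff1974, §11 Lemma 11.5] -/
theorem not_isMCriticalPt_dotFn (hx : |dotFn x| < 1) :
    ¬ IsMCriticalPt (𝓡 (n + 1)) (dotFn (hkn := hkn)) x := by
  intro hc
  -- the composite `f ∘ γ : ℝ → ℝ` has manifold derivative `0 ∘ dγ = 0` at `0` …
  have hγ : HasMFDerivAt 𝓘(ℝ, ℝ) (𝓡 (n + 1)) (circlePM x hx) 0
      (mfderiv 𝓘(ℝ, ℝ) (𝓡 (n + 1)) (circlePM x hx) 0) :=
    ((contMDiff_circlePM x hx).mdifferentiableAt (by simp)).hasMFDerivAt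
  have hf : HasMFDerivAt (𝓡 (n + 1)) 𝓘(ℝ, ℝ) (dotFn (hkn := hkn)) (circlePM x hx 0) 0 := by
    rw [circlePM_zero]
    have h := (contMDiff_dotFn (hkn := hkn)).mdifferentiableAt (x := x) (by simp) |>.hasMFDerivAt
    rwa [show mfderiv (𝓡 (n + 1)) 𝓘(ℝ, ℝ) dotFn x = 0 from hc] at h
  have hcomp := hf.comp 0 hγ
  rw [ContinuousLinearMap.zero_comp] at hcomp
  -- … but it is `t ↦ f(x) cos t + ‖w‖ sin t`, with derivative `‖w‖ ≠ 0`
  have h1 := ((Real.hasDerivAt_cos 0).const_mul (dotFn x)).add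
    ((Real.hasDerivAt_sin 0).const_mul ‖wVec x‖)
  simp only [Real.sin_zero, Real.cos_zero, mul_zero, neg_zero, mul_one, zero_add] at h1
  have hderiv := h1.congr_of_eventuallyEq (f₁ := dotFn ∘ circlePM x hx)
    (Filter.Eventually.of_forall fun t => by
      simp only [Function.comp_apply, Pi.add_apply, dotFn_circlePM x hx t])
  have h0 : HasFDerivAt (dotFn ∘ circlePM x hx) (0 : ℝ →L[ℝ] ℝ) 0 :=
    hasMFDerivAt_iff_hasFDerivAt.1 hcomp
  have := hderiv.unique h0.hasDerivAt
  exact (norm_wVec_pos x hx).ne' (by simpa using this)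

end Critical

/-! ### The tube `N_c = {⟪p, q⟫ ≥ c}` -/

/-- **Every `c ∈ (-1, 1)` is a regular level of `f = ⟪p, q⟫`** on `Sᵏ × Sᵏ` (no boundary; at a
point of the level `|f| = |c| < 1`). [cite: MilnorStasheff1974, §11 Lemma 11.5] [cite: Milnor1963, Thm. 3.1] -/
theorem isRegularLevel_dotFn {c : ℝ} (hc : |c| < 1) :
    IsRegularLevel (𝓡 (n + 1)) (dotFn (hkn := hkn)) c :=
  ⟨contMDiff_dotFn, fun _ _ => BoundarylessManifold.isInteriorPoint,
    fun x hx => not_isMCriticalPt_dotFn x (by rwa [hx])⟩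

/-- **The tube `N_c = {(p, q) ∈ Sᵏ × Sᵏ | ⟪p, q⟫ ≥ c}` of the diagonal** (`-1 < c < 1`), a compact
`C^∞` manifold with boundary `{⟪p, q⟫ = c}`: the regular superlevel set of `f = ⟪p, q⟫`
(`RegularSuperlevel`; Milnor 1963, Thm. 3.1). For `c` close to `1` this is the closed tubular
neighbourhood of `Δ`, the disc bundle of the tangent bundle of `Sᵏ` (Milnor–Stasheff, Lemma 11.5
and Thm. 11.1) — the plumbing piece of Kosinski's `M(4m)` (VI.12).
[cite: Kosinski1993, VI.12] [cite: MilnorStasheff1974, §11 Lemma 11.5 and Thm. 11.1] [cite: Milnor1963, Thm. 3.1] -/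
abbrev Tube (k n : ℕ) (hkn : k + k = n + 1) {c : ℝ} (hc : |c| < 1) : Type :=
  RegularSuperlevel (isRegularLevel_dotFn (hkn := hkn) hc)

namespace Tube

variable {c : ℝ} (hc : |c| < 1)

/-- The inclusion of the tube into `Sᵏ × Sᵏ`. [folklore] -/
def toProd (y : Tube k n hkn hc) : (𝕊 k) × (𝕊 k) :=
  pt (RegularSublevel.incl _ y)

/-- Points of the tube satisfy `⟪p, q⟫ ≥ c`. [folklore] -/
theorem le_inner_toProd (y : Tube k n hkn hc) :
    c ≤ ⟪((toProd hc y).1 : 𝔼 (k + 1)), ((toProd hc y).2 : 𝔼 (k + 1))⟫ := by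
  have h : (fun z => c - dotFn z) (RegularSublevel.incl _ y) ≤ 0 := (RegularSublevel.incl _ y |> fun _ => y.2)
  exact sub_nonpos.1 h

/-- The point of the tube given by a pair with `⟪p, q⟫ ≥ c`. [folklore] -/
def ofProd (pq : (𝕊 k) × (𝕊 k)) (h : c ≤ ⟪(pq.1 : 𝔼 (k + 1)), (pq.2 : 𝔼 (k + 1))⟫) : Tube k n hkn hc :=
  RegularSublevel.mk _ (Rechart.into (tubeModelHomeo k n hkn) _ pq) (sub_nonpos.2 h)

/-- `toProd ∘ ofProd = id`. [folklore] -/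
@[simp] theorem toProd_ofProd (pq : (𝕊 k) × (𝕊 k))
    (h : c ≤ ⟪(pq.1 : 𝔼 (k + 1)), (pq.2 : 𝔼 (k + 1))⟫) :
    toProd hc (ofProd (n := n) (hkn := hkn) hc pq h) = pq := rfl

/-- `toProd` is injective. [folklore] -/
theorem toProd_injective : Injective (toProd (k := k) (n := n) (hkn := hkn) hc) := by
  intro y y' h
  apply Subtype.ext
  exact h

include hc in
/-- The diagonal lies in every tube: `(p, p) ∈ N_c` (`⟪p, p⟫ = 1 > c`). [folklore] -/
theorem le_inner_self_diag (p : 𝕊 k) : c ≤ ⟪(p : 𝔼 (k + 1)), (p : 𝔼 (k + 1))⟫ := by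
  rw [real_inner_self_eq_norm_sq, norm_eq_of_mem_sphere p, one_pow]
  exact (abs_lt.1 hc).2.le

/-- The diagonal point `(p, p)` of the tube. [folklore] -/
def diag (p : 𝕊 k) : Tube k n hkn hc := ofProd hc (p, p) (le_inner_self_diag hc p)

/-- A point of the tube is a boundary point iff `⟪p, q⟫ = c`. [cite: Milnor1963, Thm. 3.1] -/
theorem mem_boundary_iff (y : Tube k n hkn hc) :
    y ∈ (𝓡∂ (n + 1)).boundary (Tube k n hkn hc) ↔
      ⟪((toProd hc y).1 : 𝔼 (k + 1)), ((toProd hc y).2 : 𝔼 (k + 1))⟫ = c := by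
  rw [RegularSublevel.mem_boundary_iff, sub_eq_zero, eq_comm]
  rfl

end Tube

end SphereProd

end Literature.Topology.FourManifolds

end
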